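import Mathlib
import Summits.NavierStokesRegularity.NavierStokesRegularity.Theorems.FilamentSkeletonRssAreaLawSlavingUnique

/-!
# Area-law slaving, part 11 — LOCAL uniqueness of the regular core area on a core window (interval hypotheses)
# (`FilamentSkeletonRss`, child crux `TangentSkeletonNearStraight`, stmt-NavierStokesRegularity-28295, line
# `child_tangent_analytic_strip`, ∃-side of the registered stub `stub_analyticClosing`: the `StadiumAnalyticArea` conjunct)

`Theorems.AreaLawSlaving.areaLaw_unique_window_right` (part 6) proves uniqueness of the regular solution of the area law
`w·A′ = (3/2 − w′)·A + 4` on the core window `[c, c + r]`, but with GLOBAL hypotheses (solutions and slip on all of `ℝ`).  The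
analytic continuation of the core area to the stadium (`Theorems.AreaLawSlavingHolo.areaLaw_holo`) yields a second real solution
ONLY ON THE REAL TRACE of the stadium, an interval; to identify it with the slaved area one needs the same uniqueness with hypotheses
on the interval alone.  This file re-proves part 6 §1 in that local form — same mechanism (`Ψ = (wD)²/(τ − c)²` antitone on
`(c, c + r]`, `Ψ(σ) ≤ Λ²D(σ)² → 0` as `σ → c⁺`), every use of a global hypothesis replaced by its restriction to `[c, c + r]`:

* `areaLaw_diff_hasDerivAt_at` — pointwise: `E = w·(A₁ − A₂)` has derivative `(3/2)(A₁ − A₂)` at any point where the data are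
  differentiable and both equations hold;
* `slip_abs_le_local` — `|w σ| ≤ Λ(σ − c)` on `[c, c + r]` from `|w′| ≤ Λ` there (mean value on the interval);
* `areaLaw_unique_window_right_local` — two solutions on `[c, c + r]` (differentiable there, `w(c) = 0`, `|w′| ≤ Λ` and
  `w(s) ≥ (3/2)(s − c)` on the window) agree on `[c, c + r]`.

HONEST FRAMING: elementary ODE analysis serving a HYPOTHETICAL filament skeleton on the NEGATIVE side of a MODEL route; no registered
stub is closed by this file and nothing here bears on Navier–Stokes regularity or blow-up.  `--supports stmt-NavierStokesRegularity-28295`.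
-/

set_option linter.dupNamespace false

noncomputable section

namespace Summit.NavierStokesRegularity.NavierStokesRegularity.Theorems.AreaLawSlaving

open Set Real

/-- Pointwise derivative of `w·A` under the area law at one point: `(w A)′ = (3/2)·A + 4`. [folklore] -/
theorem areaLaw_hasDerivAt_mul_at {w A : ℝ → ℝ} {τ : ℝ} (hw : DifferentiableAt ℝ w τ) (hA : DifferentiableAt ℝ A τ)
    (h : w τ * deriv A τ = (3 / 2 - deriv w τ) * A τ + 4) :
    HasDerivAt (fun s => w s * A s) (3 / 2 * A τ + 4) τ := by
  have := hw.hasDerivAt.mul hA.hasDerivAt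
  refine this.congr_deriv ?_
  linear_combination h

/-- Pointwise: for two solutions, `E = w·(A₁ − A₂)` has derivative `(3/2)·(A₁ − A₂)`. [folklore] -/
theorem areaLaw_diff_hasDerivAt_at {w A₁ A₂ : ℝ → ℝ} {τ : ℝ} (hw : DifferentiableAt ℝ w τ) (hA₁ : DifferentiableAt ℝ A₁ τ)
    (hA₂ : DifferentiableAt ℝ A₂ τ) (h₁ : w τ * deriv A₁ τ = (3 / 2 - deriv w τ) * A₁ τ + 4)
    (h₂ : w τ * deriv A₂ τ = (3 / 2 - deriv w τ) * A₂ τ + 4) :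
    HasDerivAt (fun s => w s * (A₁ s - A₂ s)) (3 / 2 * (A₁ τ - A₂ τ)) τ := by
  have h := (areaLaw_hasDerivAt_mul_at hw hA₁ h₁).sub (areaLaw_hasDerivAt_mul_at hw hA₂ h₂)
  have heq : (fun s => w s * (A₁ s - A₂ s)) = fun s => w s * A₁ s - w s * A₂ s := by funext s; ring
  rw [heq]
  exact h.congr_deriv (by ring)

/-- Local slip bound: `w(c) = 0` and `|w′| ≤ Λ` on `[c, c + r]` give `|w σ| ≤ Λ(σ − c)` there. [folklore] -/
theorem slip_abs_le_local {w : ℝ → ℝ} {c r Λ : ℝ} (hw : ∀ s ∈ Icc c (c + r), DifferentiableAt ℝ w s) (hc : w c = 0)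
    (hΛ : ∀ s ∈ Icc c (c + r), |deriv w s| ≤ Λ) {σ : ℝ} (hσ : σ ∈ Icc c (c + r)) : |w σ| ≤ Λ * (σ - c) := by
  have hr : c ≤ c + r := hσ.1.trans hσ.2
  have hcI : c ∈ Icc c (c + r) := ⟨le_rfl, hr⟩
  have h := (convex_Icc c (c + r)).norm_image_sub_le_of_norm_deriv_le (f := w) (fun x hx => hw x hx)
    (fun x hx => by rw [Real.norm_eq_abs]; exact hΛ x hx) hcI hσ
  rw [hc, sub_zero, Real.norm_eq_abs, Real.norm_eq_abs, abs_of_nonneg (sub_nonneg.2 hσ.1)] at h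
  exact h

/-- **Local uniqueness on the right core window.**  On `[c, c + r]`: `w, A₁, A₂` differentiable, both area laws hold, `w(c) = 0`,
`|w′| ≤ Λ`, and `w(s) ≥ (3/2)(s − c)`.  Then `A₁ = A₂` on `[c, c + r]`. [folklore] -/
theorem areaLaw_unique_window_right_local {w A₁ A₂ : ℝ → ℝ} {c r Λ : ℝ}
    (hw : ∀ s ∈ Icc c (c + r), DifferentiableAt ℝ w s) (hA₁ : ∀ s ∈ Icc c (c + r), DifferentiableAt ℝ A₁ s)
    (hA₂ : ∀ s ∈ Icc c (c + r), DifferentiableAt ℝ A₂ s)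
    (h₁ : ∀ s ∈ Icc c (c + r), w s * deriv A₁ s = (3 / 2 - deriv w s) * A₁ s + 4)
    (h₂ : ∀ s ∈ Icc c (c + r), w s * deriv A₂ s = (3 / 2 - deriv w s) * A₂ s + 4) (hc : w c = 0)
    (hΛ : ∀ s ∈ Icc c (c + r), |deriv w s| ≤ Λ) (hwin : ∀ s ∈ Icc c (c + r), 3 / 2 * (s - c) ≤ w s)
    {τ : ℝ} (hτ : c ≤ τ) (hτr : τ ≤ c + r) : A₁ τ = A₂ τ := by
  have hcI : c ∈ Icc c (c + r) := ⟨le_rfl, hτ.trans hτr⟩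
  -- agreement at the zero
  have hDc0 : A₁ c = A₂ c := by
    have e₁ := h₁ c hcI
    have e₂ := h₂ c hcI
    rw [hc, zero_mul] at e₁ e₂
    have hne : 3 / 2 - deriv w c ≠ 0 := by
      intro h0
      rw [h0, zero_mul, zero_add] at e₁
      norm_num at e₁
    have : (3 / 2 - deriv w c) * (A₁ c - A₂ c) = 0 := by linarith
    rcases mul_eq_zero.1 this with h | h
    · exact absurd h hne
    · linarith
  rcases hτ.eq_or_lt with h | hτ'
  · rw [← h]; exact hDc0
  set D : ℝ → ℝ := fun s => A₁ s - A₂ s with hD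
  have hDc : D c = 0 := by rw [hD]; simp only; rw [hDc0, sub_self]
  have hE : ∀ s ∈ Icc c (c + r), HasDerivAt (fun s => w s * D s) (3 / 2 * D s) s := fun s hs =>
    areaLaw_diff_hasDerivAt_at (hw s hs) (hA₁ s hs) (hA₂ s hs) (h₁ s hs) (h₂ s hs)
  -- Ψ = (w D)² / (s - c)² is antitone on (c, c + r]
  have hΨd : ∀ s ∈ Icc c (c + r), c < s → HasDerivAt (fun s => (w s * D s) ^ 2 / (s - c) ^ 2)
      ((2 * (w s * D s) * (3 / 2 * D s) * (s - c) ^ 2 - (w s * D s) ^ 2 * (2 * (s - c))) / ((s - c) ^ 2) ^ 2) s := by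
    intro s hsI hs
    have hsc : (s - c) ^ 2 ≠ 0 := pow_ne_zero 2 (sub_pos.2 hs).ne'
    have hn : HasDerivAt (fun s => (w s * D s) ^ 2) (2 * (w s * D s) * (3 / 2 * D s)) s := by
      have := (hE s hsI).fun_pow 2
      exact this.congr_deriv (by ring)
    have hd : HasDerivAt (fun s => (s - c) ^ 2) (2 * (s - c)) s := by
      have := ((hasDerivAt_id' s).sub_const c).fun_pow 2
      exact this.congr_deriv (by simp)
    exact hn.div hd hsc
  have hanti : AntitoneOn (fun s => (w s * D s) ^ 2 / (s - c) ^ 2) (Ioc c (c + r)) := by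
    apply antitoneOn_of_deriv_nonpos (convex_Ioc c (c + r))
    · exact HasDerivAt.continuousOn fun s hs => hΨd s ⟨hs.1.le, hs.2⟩ hs.1
    · intro s hs
      rw [interior_Ioc] at hs
      exact (hΨd s ⟨hs.1.le, hs.2.le⟩ hs.1).differentiableAt.differentiableWithinAt
    · intro s hs
      rw [interior_Ioc] at hs
      rw [(hΨd s ⟨hs.1.le, hs.2.le⟩ hs.1).deriv]
      have hsc : 0 < s - c := sub_pos.2 hs.1
      have hws : 3 / 2 * (s - c) ≤ w s := hwin s ⟨hs.1.le, hs.2.le⟩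
      have hnum : 2 * (w s * D s) * (3 / 2 * D s) * (s - c) ^ 2 - (w s * D s) ^ 2 * (2 * (s - c)) =
          2 * (s - c) * w s * D s ^ 2 * (3 / 2 * (s - c) - w s) := by ring
      rw [hnum]
      apply div_nonpos_of_nonpos_of_nonneg _ (by positivity)
      have h1 : 0 ≤ 2 * (s - c) * w s * D s ^ 2 := by
        have : 0 ≤ w s := le_trans (by positivity) hws
        positivity
      exact mul_nonpos_of_nonneg_of_nonpos h1 (by linarith)
  -- Ψ(τ) ≤ ε for every ε > 0
  have hΨτ_le : ∀ ε, 0 < ε → (w τ * D τ) ^ 2 / (τ - c) ^ 2 ≤ ε := by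
    intro ε hε
    have hDcont : ContinuousAt D c := ((hA₁ c hcI).sub (hA₂ c hcI)).continuousAt
    have hΛ0 : 0 ≤ Λ := le_trans (abs_nonneg _) (hΛ c hcI)
    obtain ⟨η, hη, hηD⟩ : ∃ η > 0, ∀ s, |s - c| < η → (Λ ^ 2 + 1) * D s ^ 2 < ε := by
      have hct : ContinuousAt (fun s => (Λ ^ 2 + 1) * D s ^ 2) c := (hDcont.pow 2).const_mul _
      have h0 : (fun s => (Λ ^ 2 + 1) * D s ^ 2) c < ε := by simp only [hDc]; simpa using hε
      have hev := hct.eventually (gt_mem_nhds h0)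
      obtain ⟨η, hη, hball⟩ := Metric.eventually_nhds_iff.1 hev
      exact ⟨η, hη, fun s hs => hball (by rw [Real.dist_eq]; exact hs)⟩
    set σ : ℝ := c + min (η / 2) (τ - c) with hσ
    have hσc : c < σ := by
      rw [hσ]; have : 0 < min (η / 2) (τ - c) := lt_min (by linarith) (sub_pos.2 hτ'); linarith
    have hστ : σ ≤ τ := by rw [hσ]; have := min_le_right (η / 2) (τ - c); linarith
    have hση : |σ - c| < η := by
      rw [abs_of_pos (sub_pos.2 hσc), hσ]; have := min_le_left (η / 2) (τ - c); linarith
    have hσI : σ ∈ Icc c (c + r) := ⟨hσc.le, hστ.trans hτr⟩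
    have hmono := hanti ⟨hσc, hστ.trans hτr⟩ ⟨hτ', hτr⟩ hστ
    have hwσ : |w σ| ≤ Λ * (σ - c) := slip_abs_le_local hw hc hΛ hσI
    have hσpos : 0 < σ - c := sub_pos.2 hσc
    have hΨσ : (w σ * D σ) ^ 2 / (σ - c) ^ 2 ≤ Λ ^ 2 * D σ ^ 2 := by
      rw [div_le_iff₀ (pow_pos hσpos 2), mul_pow]
      have h1 : w σ ^ 2 ≤ (Λ * (σ - c)) ^ 2 := by
        rw [← sq_abs (w σ)]; exact pow_le_pow_left₀ (abs_nonneg _) hwσ 2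
      rw [mul_pow] at h1
      nlinarith [sq_nonneg (D σ)]
    have hfin : Λ ^ 2 * D σ ^ 2 ≤ ε := by nlinarith [hηD σ hση, sq_nonneg (D σ)]
    exact hmono.trans (hΨσ.trans hfin)
  have hΨ0 : (w τ * D τ) ^ 2 / (τ - c) ^ 2 ≤ 0 := by
    by_contra hpos
    push Not at hpos
    have := hΨτ_le ((w τ * D τ) ^ 2 / (τ - c) ^ 2 / 2) (by positivity)
    linarith
  have hτc : 0 < τ - c := sub_pos.2 hτ'
  have hΨnn : 0 ≤ (w τ * D τ) ^ 2 / (τ - c) ^ 2 := by positivity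
  have hzero : (w τ * D τ) ^ 2 = 0 := by
    have := le_antisymm hΨ0 hΨnn
    rwa [div_eq_zero_iff, or_iff_left (pow_ne_zero 2 hτc.ne')] at this
  have hwτ : 0 < w τ := lt_of_lt_of_le (by positivity) (hwin τ ⟨hτ, hτr⟩)
  have : D τ = 0 := by
    have h := pow_eq_zero_iff (n := 2) (by norm_num) |>.1 hzero
    rcases mul_eq_zero.1 h with h | h
    · exact absurd h hwτ.ne'
    · exact h
  have : A₁ τ - A₂ τ = 0 := this
  linarith

end Summit.NavierStokesRegularity.NavierStokesRegularity.Theorems.AreaLawSlaving
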